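import Mathlib

/-!
# PercRepro — night-2: coloops of a SET and the coloop lemma (blind cell pub-perc-repro)

For a matroid `M` and a set `X` the *coloops of `X`* are the elements `x ∈ X` with `r(X ∖ x) < r(X)`
(the coloops of `M ↾ X`). They are independent, so there are at most `r(X)` of them, and adding an
element `e ∉ cl(X)` adds exactly `e` to the coloops (Lemma 1 of `proofs/NIGHT-2-injection.md`):
`K(X ∪ e) = K(X) ∪ {e}`. This is the whole S-side of the first-layer weighting for C-025.
-/

namespace PercRepro
namespace Matroid

open Set

variable {α : Type*} {M : _root_.Matroid α}

/-- The coloops of the set `X`: elements of `X` whose removal lowers the rank. -/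
def setColoops (M : _root_.Matroid α) (X : Set α) : Set α :=
  {x ∈ X | M.eRk (X \ {x}) < M.eRk X}

/-- Membership in `setColoops`. -/
theorem mem_setColoops_iff {X : Set α} {x : α} :
    x ∈ setColoops M X ↔ x ∈ X ∧ M.eRk (X \ {x}) < M.eRk X := Iff.rfl

/-- Coloops of a set lie in the set. -/
theorem setColoops_subset (M : _root_.Matroid α) (X : Set α) : setColoops M X ⊆ X :=
  fun _ hx => hx.1

/-- A coloop of `X` is not in the closure of the rest of `X`. -/
theorem notMem_closure_diff_of_mem_setColoops {X : Set α} (hX : X ⊆ M.E) {x : α}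
    (hx : x ∈ setColoops M X) : x ∉ M.closure (X \ {x}) := by
  intro h
  have h1 : M.closure (X \ {x}) = M.closure X := by
    refine (M.closure_subset_closure sdiff_subset).antisymm ?_
    refine M.closure_subset_closure_of_subset_closure ?_
    intro y hy
    by_cases hyx : y = x
    · exact hyx ▸ h
    · exact M.mem_closure_of_mem' ⟨hy, hyx⟩ (hX hy)
  have h2 : M.eRk (X \ {x}) = M.eRk X := by
    rw [← M.eRk_closure_eq (X \ {x}), h1, M.eRk_closure_eq]
  exact absurd hx.2 (by rw [h2]; exact lt_irrefl _)

/-- The coloops of a set are independent (needs `X ⊆ M.E`). -/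
theorem setColoops_indep {X : Set α} (hX : X ⊆ M.E) : M.Indep (setColoops M X) := by
  rw [_root_.Matroid.indep_iff_forall_notMem_closure_sdiff ((setColoops_subset M X).trans hX)]
  intro x hx hcl
  exact notMem_closure_diff_of_mem_setColoops hX hx
    (M.closure_subset_closure (sdiff_subset_sdiff_left (setColoops_subset M X)) hcl)

/-- At most `r(X)` coloops: `|K(X)| ≤ r(X)` (as extended naturals). -/
theorem encard_setColoops_le {X : Set α} (hX : X ⊆ M.E) :
    (setColoops M X).encard ≤ M.eRk X :=
  (setColoops_indep hX).encard_le_eRk_of_subset (setColoops_subset M X)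

/-- `|K(X)| ≤ r(X)` for a finite set, as natural numbers. -/
theorem ncard_setColoops_le {X : Set α} (hX : X ⊆ M.E) (hfin : X.Finite) {u : ℕ}
    (hu : M.eRk X = u) : (setColoops M X).ncard ≤ u := by
  have h := encard_setColoops_le hX
  rw [hu, ← (hfin.subset (setColoops_subset M X)).cast_ncard_eq] at h
  exact_mod_cast h

/-- **Lemma 1 (the coloop lemma).** If `e ∈ M.E` is not in the closure of `X` (finite rank),
then the coloops of `X ∪ {e}` are the coloops of `X` together with `e`. -/
theorem setColoops_insert {X : Set α} (hX : M.IsRkFinite X) {e : α}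
    (he : e ∈ M.E \ M.closure X) :
    setColoops M (insert e X) = insert e (setColoops M X) := by
  have heX : e ∉ X := fun h => he.2 (M.mem_closure_of_mem' h he.1)
  have hins : M.eRk (insert e X) = M.eRk X + 1 := M.eRk_insert_eq_add_one he
  have htop : M.eRk X ≠ ⊤ := hX.eRk_lt_top.ne
  ext x
  simp only [mem_setColoops_iff, mem_insert_iff]
  constructor
  · rintro ⟨hx, hlt⟩
    rcases hx with rfl | hxX
    · exact Or.inl rfl
    · refine Or.inr ⟨hxX, ?_⟩
      have hne : x ≠ e := fun h => heX (h ▸ hxX)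
      have hdiff : insert e X \ {x} = insert e (X \ {x}) := by
        ext y; simp only [mem_sdiff, mem_insert_iff, mem_singleton_iff]
        constructor
        · rintro ⟨h1 | h1, h2⟩
          · exact Or.inl h1
          · exact Or.inr ⟨h1, h2⟩
        · rintro (h1 | ⟨h1, h2⟩)
          · exact ⟨Or.inl h1, h1 ▸ hne.symm⟩
          · exact ⟨Or.inr h1, h2⟩
      have he' : e ∈ M.E \ M.closure (X \ {x}) :=
        ⟨he.1, fun h => he.2 (M.closure_subset_closure sdiff_subset h)⟩
      rw [hdiff, M.eRk_insert_eq_add_one he', hins] at hlt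
      exact (ENat.add_lt_add_iff_right ENat.one_ne_top).1 hlt
  · rintro (rfl | ⟨hxX, hlt⟩)
    · refine ⟨Or.inl rfl, ?_⟩
      have hdiff : insert x X \ {x} = X := by
        ext y; simp only [mem_sdiff, mem_insert_iff, mem_singleton_iff]
        constructor
        · rintro ⟨h1 | h1, h2⟩
          · exact absurd h1 h2
          · exact h1
        · intro h1; exact ⟨Or.inr h1, fun h => heX (h ▸ h1)⟩
      rw [hdiff, hins]
      exact ENat.lt_add_one_iff htop |>.2 le_rfl
    · refine ⟨Or.inr hxX, ?_⟩
      have hne : x ≠ e := fun h => heX (h ▸ hxX)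
      have hdiff : insert e X \ {x} = insert e (X \ {x}) := by
        ext y; simp only [mem_sdiff, mem_insert_iff, mem_singleton_iff]
        constructor
        · rintro ⟨h1 | h1, h2⟩
          · exact Or.inl h1
          · exact Or.inr ⟨h1, h2⟩
        · rintro (h1 | ⟨h1, h2⟩)
          · exact ⟨Or.inl h1, h1 ▸ hne.symm⟩
          · exact ⟨Or.inr h1, h2⟩
      have he' : e ∈ M.E \ M.closure (X \ {x}) :=
        ⟨he.1, fun h => he.2 (M.closure_subset_closure sdiff_subset h)⟩
      rw [hdiff, M.eRk_insert_eq_add_one he', hins]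
      exact (ENat.add_lt_add_iff_right ENat.one_ne_top).2 hlt

/-- Corollary 2 (multiplicity): if `e` is a coloop of `S` then `S ∖ e` has rank one less and `e` is
outside its closure — so every rank-`(q+1)` set `S` arises as `T ∪ {e}` (with `r(T) = q`,
`e ∉ cl T`) exactly from its coloops. -/
theorem eRk_diff_singleton_add_one_of_mem_setColoops {S : Set α} (hS : S ⊆ M.E) {e : α}
    (he : e ∈ setColoops M S) :
    M.eRk S = M.eRk (S \ {e}) + 1 ∧ e ∉ M.closure (S \ {e}) := by
  refine ⟨?_, notMem_closure_diff_of_mem_setColoops hS he⟩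
  have h1 : M.eRk S ≤ M.eRk (S \ {e}) + 1 := by
    have : S ⊆ insert e (S \ {e}) := fun y hy => by
      by_cases hye : y = e
      · exact hye ▸ mem_insert _ _
      · exact mem_insert_of_mem _ ⟨hy, hye⟩
    exact (M.eRk_mono this).trans (M.eRk_insert_le_add_one e (S \ {e}))
  have h2 : M.eRk (S \ {e}) < M.eRk S := he.2
  exact le_antisymm h1 (Order.add_one_le_of_lt h2)

end Matroid
end PercRepro
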